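import Mathlib
import HarnessLib
import Summits.Ventures.LatticeQCDFlow.Scaling.TiltedLinearProtocol
import Summits.Ventures.LatticeQCDFlow.Scaling.StochasticBudgets

/-!
# GeneralLayerESSFloor — the non-equilibrium PATH ESS of the uniform switching protocol with
# ARBITRARY relaxation layers cannot fall below the PERFECT-RELAXATION ESS by more than the
# second-moment lag budget: `ÊSS ≥ ÊSS_perfect · exp(−(2θ₂/(1−θ₂))·σ̄²/n)`,
# `ÊSS ≥ exp(−(e^{ΔD/n} + 2θ₂/(1−θ₂))·σ̄²/n)`, `θ₂ = ρ·e^{3ΔD/n}`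

HONEST FRAMING: exact (Metropolis-corrected) sampling algorithms for lattice gauge theory;
figures of merit are autocorrelation/cost numbers at stated couplings and volumes; no
continuum-physics claim.

Venture `LatticeQCDFlow` (cell pub-lqcd), topic `Scaling`; FANOUT row 19 (`su2-snf`, GEN-6).
OUR WORK (elementary finite sums), nothing cited as a fact.  The companion of row 19 GEN-5's
ceiling `Scaling/GeneralLayerESSCeiling` (`ÊSS ≤ exp(−[(⟨D⟩_0 − ⟨D⟩_1)/(2n) − (θ/(1−θ))σ̄²/n −
M₃/(12n²)])`, "NOT CLAIMED: the matching FLOOR … needs exponential moments of `W`").  Here the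
exponential moment `E_F[e^{−2W}]` IS controlled, for EVERY family of positive layers leaving the
Boltzmann weights invariant that `χ²`-contract towards their targets with coefficient `ρ`
(`Scaling/ChiSqContraction`; `ρ = λ⋆` for reversible irreducible layers), via the tilted
Feynman–Kac recursion of `Scaling/TiltedProtocolRecursion` / `Scaling/TiltedLinearProtocol`:

* `ess_path_eq_sq_div_tiltMass`, **`ess_path_eq_prod_essFrac_mul`** — along ANY grid,
  `ÊSS_layers = (Z(c_n)/Z(c_0))²/|ν_n| = [Π_{k<n} ESS(π_{c_{k+1}}, π_{c_k})] · (p_n/|ν_n|)` EXACTLY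
  (`p_n = Π_k Z(c_k+2δ_k)/Z(c_k)` the perfect-relaxation second moment and the telescoping
  `prod_essFrac_mul_perfSqMass` of `TiltedLinearProtocol`): the path ESS with arbitrary layers is
  the perfect-relaxation product (theory-2's `ess_perfect_relaxation`) times the ratio of the
  perfect to the actual tilted mass;
* **`tiltMass_uniform_le`** — along `c_k = k/n` with `|D x − D y| ≤ ΔD`, `Var_c(D) ≤ σ̄²` (all `c`),
  `θ₂ = ρe^{3ΔD/n} < 1`: `|ν_n| ≤ p_n · exp((2θ₂/(1−θ₂))·σ̄²/n)` (the 2×2 majorant system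
  `u_{k+1} ≤ u_k + (2e^{ΔD/n}σ̄/n)v_k`, `v_{k+1} ≤ (ρe^{ΔD/(2n)}σ̄/n)u_k + θ₂v_k` for
  `u_k = |ν_k|/p_k`, `v_k = massDev π_{k/n} ν_k / p_k`, `coupled_majorant_exp_bound`);
* **`prod_essFrac_mul_exp_le_ess_path_uniform` — THE COMPARISON FLOOR**:
  `[Π_{k<n} ESS(π_{(k+1)/n}, π_{k/n})] · exp(−(2θ₂/(1−θ₂))·σ̄²/n) ≤ ÊSS_layers`;
  `ess_perfect_mul_exp_le_ess_path_uniform` — the same with the product identified as the path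
  ESS of PERFECT relaxation (`Theory2.ess_perfect_relaxation`): no `χ²`-contracting relaxation
  scheme loses more than the factor `exp(−(2θ₂/(1−θ₂))σ̄²/n)` against perfect relaxation;
* **`exp_le_ess_path_uniform` — THE EXPLICIT FLOOR**:
  `exp(−(e^{ΔD/n} + 2θ₂/(1−θ₂))·σ̄²/n) ≤ ÊSS_layers` (each perfect factor is
  `(1 + χ²(π_{(k+1)/n} ‖ π_{k/n}))⁻¹ ≥ exp(−e^{ΔD/n}σ̄²/n²)`);
  `exp_le_ess_path_uniform_of_reversible` — the instance for positive stochastic layers in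
  detailed balance with their targets and irreducible, `ρ = max_k λ⋆(P_k)`.

Reading (value-free).  As `n → ∞` at fixed `ρ`: `−log ÊSS ≤ ((1+ρ)/(1−ρ))·σ̄²/n·(1+o(1))
= 2τ̄·σ̄²/n` — E7's empirical `−log ÊSS = k′ n_dof/n_step` with `k′ = 2τ_int·σ²Δ²`
(arXiv:2510.25704 §4) as a CERTIFIED UPPER ENVELOPE on `−log ÊSS` for arbitrary reversible layers;
the leading constant `(1+ρ)/(1−ρ)` is ATTAINED by the exactly solvable AR(1) switching model
(`Scaling/AR1SwitchingJarzynski`: `−log ESS = Δ²(1+ρ)/(1−ρ)·N/n`), so the factor `2` in the lag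
budget is sharp.  With GEN-5's ceiling: `(⟨D⟩_0−⟨D⟩_1)/(2n) − (θ/(1−θ))σ̄²/n − M₃/(12n²) ≤ −log ÊSS
≤ (e^{ΔD/n} + 2θ₂/(1−θ₂))σ̄²/n`.
Layer families are indexed by every `k : ℕ` (extend a finite family by perfect relaxation onto the
next Gibbs law).  NOT CLAIMED: any value of `ρ`, `σ̄`, `ΔD` for a lattice kernel (informative only
when `ρe^{3ΔD/n} < 1`); non-positive layers; non-uniform grids for the closed form (the identity
`ess_path_eq_prod_essFrac_mul` and the per-step inequalities of `TiltedLinearProtocol` hold on any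
grid); the SAMPLE (Kish) ESS of a finite run (`Exactness/SampleESS`).
-/

namespace Summit.Ventures.LatticeQCDFlow.Scaling

open Finset
open Literature.Probability.MarkovChains (IsRowStochastic IsStationary stepLaw DetailedBalance
  IsIrreducible lambdaStar lambdaStar_nonneg)
open Literature.Probability.ImportanceSampling (chiSqDiv chiSqDiv_def chiSqDiv_eq_sum_sq_div)
open Summit.Ventures.LatticeQCDFlow.Exactness
open Summit.Ventures.LatticeQCDFlow.Theory2

variable {X : Type*} [Fintype X] [Nonempty X]

/-! ## The exact structure: perfect-relaxation product times the tilted-mass ratio -/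

/-- **The reweighting ESS of the path law is `(Z_n/Z_0)²` over the tilted mass** (theory-2's
`ÊSS = ⟨e^{−W}⟩²/⟨e^{−2W}⟩`, Jarzynski, and `E_F[(e^{−W})²] = |ν_n|`). -/
theorem ess_path_eq_sq_div_tiltMass (S₀ D : X → ℝ) (c : ℕ → ℝ) (P : ℕ → X → X → ℝ) (n : ℕ)
    (hPpos : ∀ k x y, 0 < P k x y)
    (hst : ∀ k, IsStationary (fun x => Real.exp (-(linAction S₀ D (c (k + 1)) x))) (P k)) :
    essFrac (revPathLaw (fun k : Fin (n + 1) => linAction S₀ D (c k)) (fun k : Fin n => P k))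
        (pathLaw (gibbsLaw (linAction S₀ D (c ((0 : Fin (n + 1)) : ℕ)))) (fun k : Fin n => P k))
      = (partitionFn (linAction S₀ D (c n)) / partitionFn (linAction S₀ D (c 0))) ^ 2
          / ∑ x, sqTiltLaw S₀ D c P n x := by
  have hP' : ∀ (k : Fin n) x y, 0 < (fun k : Fin n => P k) k x y := fun k x y => hPpos k x y
  have hst' : ∀ k : Fin n, IsStationary
      (fun x => Real.exp (-(fun k : Fin (n + 1) => linAction S₀ D (c k)) k.succ x))
      ((fun k : Fin n => P k) k) := by
    intro k; simpa only [Fin.val_succ] using hst k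
  rw [essFrac_path_eq (fun k : Fin (n + 1) => linAction S₀ D (c k)) hP',
    jarzynski (fun k : Fin (n + 1) => linAction S₀ D (c k)) (fun k : Fin n => P k) hst']
  simp only [Fin.val_last, Fin.val_zero]
  rw [sum_pathLaw_exp_neg_work_sq_eq S₀ D c P n]

/-- **EXACT STRUCTURE THEOREM (any grid).**  The path ESS with arbitrary positive
Boltzmann-invariant layers equals the perfect-relaxation product `Π_{k<n} ESS(π_{c_{k+1}}, π_{c_k})`
(theory-2's `ess_perfect_relaxation`) times the ratio `p_n/|ν_n|` of the perfect to the actual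
tilted second moment. -/
theorem ess_path_eq_prod_essFrac_mul (S₀ D : X → ℝ) (c : ℕ → ℝ) (P : ℕ → X → X → ℝ) (n : ℕ)
    (hPpos : ∀ k x y, 0 < P k x y)
    (hst : ∀ k, IsStationary (fun x => Real.exp (-(linAction S₀ D (c (k + 1)) x))) (P k)) :
    essFrac (revPathLaw (fun k : Fin (n + 1) => linAction S₀ D (c k)) (fun k : Fin n => P k))
        (pathLaw (gibbsLaw (linAction S₀ D (c ((0 : Fin (n + 1)) : ℕ)))) (fun k : Fin n => P k))
      = (∏ k ∈ Finset.range n,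
          essFrac (gibbsLaw (linAction S₀ D (c (k + 1)))) (gibbsLaw (linAction S₀ D (c k))))
        * (perfSqMass S₀ D c n / ∑ x, sqTiltLaw S₀ D c P n x) := by
  rw [ess_path_eq_sq_div_tiltMass S₀ D c P n hPpos hst, ← prod_essFrac_mul_perfSqMass S₀ D c n]
  ring

/-! ## The uniform grid: the tilted mass exceeds the perfect one by at most the lag budget -/

section Uniform

/-- **TILTED MASS ALONG THE UNIFORM PROTOCOL.**  With positive layers of unit row sums that
`χ²`-contract towards their targets with `ρ ≥ 0`, `|D x − D y| ≤ ΔD`, `Var_c(D) ≤ σ̄²` for all `c`,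
and `θ₂ = ρ·e^{3ΔD/n} < 1`:  `|ν_n| ≤ p_n · exp((2θ₂/(1−θ₂))·σ̄²/n)`. -/
theorem tiltMass_uniform_le (S₀ D : X → ℝ) (P : ℕ → X → X → ℝ) {n : ℕ} (hn : n ≠ 0)
    {ΔD ρ σbar : ℝ} (hD : ∀ x y, |D x - D y| ≤ ΔD) (hPpos : ∀ k x y, 0 < P k x y)
    (hProw : ∀ k x, ∑ y, P k x y = 1)
    (hK : ∀ k, ChiSqContracts (P k) (gibbsLaw (linAction S₀ D (((k + 1 : ℕ) : ℝ) / n))) ρ)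
    (hρ : 0 ≤ ρ) (hσ0 : 0 ≤ σbar) (hσ : ∀ c, varD S₀ D c ≤ σbar ^ 2)
    (hθ1 : ρ * Real.exp (3 * ΔD / n) < 1) :
    ∑ x, sqTiltLaw S₀ D (fun k : ℕ => (k : ℝ) / n) P n x
      ≤ perfSqMass S₀ D (fun k : ℕ => (k : ℝ) / n) n
          * Real.exp (2 * (ρ * Real.exp (3 * ΔD / n)) / (1 - ρ * Real.exp (3 * ΔD / n))
              * (σbar ^ 2 / n)) := by
  set c : ℕ → ℝ := fun k => (k : ℝ) / n with hc
  have hn' : (0 : ℝ) < n := Nat.cast_pos.mpr (Nat.pos_of_ne_zero hn)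
  have hΔ : 0 ≤ ΔD := (abs_nonneg _).trans (hD (Classical.arbitrary X) (Classical.arbitrary X))
  have hδabs : ∀ k, |c (k + 1) - c k| = 1 / n := by
    intro k; rw [hc]; simp only; rw [uniform_step, abs_of_nonneg (by positivity)]
  -- the two sequences and the constants of the majorant system
  set m : ℕ → ℝ := fun k => ∑ x, sqTiltLaw S₀ D c P k x with hm
  set E : ℕ → ℝ := fun k => massDev (gibbsLaw (linAction S₀ D (c k))) (sqTiltLaw S₀ D c P k) with hE
  set p : ℕ → ℝ := fun k => perfSqMass S₀ D c k with hp
  set gb : ℕ → ℝ := fun k => ∑ x, gibbsLaw (linAction S₀ D (c k)) x * sqWeight D c k x with hgb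
  have hp0 : ∀ k, 0 < p k := fun k => perfSqMass_pos S₀ D c k
  have hgb0 : ∀ k, 0 < gb k := fun k => eqFactor_pos S₀ D c k
  have hpsucc : ∀ k, p (k + 1) = p k * gb k := fun k => perfSqMass_succ S₀ D c k
  have hm0 : ∀ k, 0 ≤ m k := fun k => sum_nonneg fun x _ => (sqTiltLaw_pos hPpos k x).le
  have hE0 : ∀ k, 0 ≤ E k := fun k => massDev_nonneg _ _
  set s : ℝ := 2 / n * Real.exp (ΔD / n) * σbar with hs
  set a : ℝ := ρ * (1 / n * Real.exp (ΔD / n / 2) * σbar) with ha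
  set θ : ℝ := ρ * Real.exp (3 * ΔD / n) with hθ
  have hs0 : 0 ≤ s := by positivity
  have ha0 : 0 ≤ a := by positivity
  have hθ0 : 0 ≤ θ := by positivity
  -- per-step inequalities
  have hu : ∀ k, m (k + 1) / p (k + 1) ≤ m k / p k + s * (E k / p k) := by
    intro k
    have step := sum_tiltLaw_succ_le S₀ D c P hD hProw hσ0 hσ k
    rw [hδabs k, show 1 / (n : ℝ) * ΔD = ΔD / n by ring] at step
    rw [hpsucc, div_le_iff₀ (mul_pos (hp0 k) (hgb0 k))]
    have hpk := (hp0 k).ne'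
    have e : (m k / p k + s * (E k / p k)) * (p k * gb k)
        = gb k * (m k + 2 * (1 / n) * Real.exp (ΔD / n) * σbar * E k) := by
      rw [hs]; field_simp
    rw [e]
    exact step
  have hv : ∀ k, E (k + 1) / p (k + 1) ≤ a * (m k / p k) + θ * (E k / p k) := by
    intro k
    have step := massDev_tiltLaw_succ_le S₀ D c P hD hPpos hProw (fun k => hK k) hρ hσ0 hσ k
    rw [hδabs k, show 3 * (1 / (n : ℝ) * ΔD) = 3 * ΔD / n by ring,
      show 1 / (n : ℝ) * ΔD / 2 = ΔD / n / 2 by ring] at step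
    rw [hpsucc, div_le_iff₀ (mul_pos (hp0 k) (hgb0 k))]
    have hpk := (hp0 k).ne'
    have e : (a * (m k / p k) + θ * (E k / p k)) * (p k * gb k)
        = ρ * gb k * (Real.exp (3 * ΔD / n) * E k
            + 1 / n * Real.exp (ΔD / n / 2) * σbar * m k) := by
      rw [ha, hθ]; field_simp; ring
    rw [e]
    exact step
  -- initial values
  have hu0 : m 0 / p 0 ≤ 1 := by
    rw [hm, hp]; simp only
    rw [sqTiltLaw_zero, sum_gibbsLaw, perfSqMass, Finset.prod_range_zero, div_one]
  have hv0 : E 0 / p 0 ≤ 0 := by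
    rw [hE, hp]; simp only
    rw [sqTiltLaw_zero, massDev_of_sum_eq_one _ (sum_gibbsLaw _), chiSqDiv_self_eq_zero,
      Real.sqrt_zero, zero_div]
  -- the majorant system
  have hθ1' : θ < 1 := hθ1
  have hbound := coupled_majorant_exp_bound (u := fun k => m k / p k) (v := fun k => E k / p k)
    hs0 ha0 hθ0 hθ1' hu0 hv0 hu hv n
  -- compare the rate with the lag budget
  have hrate : (n : ℝ) * (s * a / (1 - θ)) ≤ 2 * θ / (1 - θ) * (σbar ^ 2 / n) := by
    have h1θ : 0 < 1 - θ := by linarith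
    have hexp : Real.exp (ΔD / n) * Real.exp (ΔD / n / 2) ≤ Real.exp (3 * ΔD / n) := by
      rw [← Real.exp_add]
      refine Real.exp_le_exp.mpr ?_
      have : 0 ≤ ΔD / n := div_nonneg hΔ hn'.le
      rw [show ΔD / n + ΔD / n / 2 = (3 / 2) * (ΔD / n) by ring,
        show 3 * ΔD / n = 3 * (ΔD / n) by ring]
      linarith
    have hsa : (n : ℝ) * (s * a) ≤ 2 * θ * (σbar ^ 2 / n) := by
      rw [hs, ha, hθ]
      have e1 : (n : ℝ) * (2 / n * Real.exp (ΔD / n) * σbar * (ρ * (1 / n * Real.exp (ΔD / n / 2) * σbar)))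
          = 2 * (ρ * (Real.exp (ΔD / n) * Real.exp (ΔD / n / 2))) * (σbar ^ 2 / n) := by
        field_simp
      rw [e1]
      have := mul_le_mul_of_nonneg_left hexp hρ
      have hσn : 0 ≤ σbar ^ 2 / n := by positivity
      nlinarith [this, hσn]
    rw [show (n : ℝ) * (s * a / (1 - θ)) = (n : ℝ) * (s * a) / (1 - θ) by ring,
      show 2 * θ / (1 - θ) * (σbar ^ 2 / n) = 2 * θ * (σbar ^ 2 / n) / (1 - θ) by ring]
    exact div_le_div_of_nonneg_right hsa h1θ.le
  have hfin : m n / p n ≤ Real.exp (2 * θ / (1 - θ) * (σbar ^ 2 / n)) :=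
    hbound.trans (Real.exp_le_exp.mpr hrate)
  calc m n ≤ Real.exp (2 * θ / (1 - θ) * (σbar ^ 2 / n)) * p n := (div_le_iff₀ (hp0 n)).mp hfin
    _ = p n * Real.exp (2 * θ / (1 - θ) * (σbar ^ 2 / n)) := mul_comm _ _

/-- **THE COMPARISON FLOOR.**  Under the hypotheses of `tiltMass_uniform_le`, with layers leaving
the Boltzmann weights invariant:
`[Π_{k<n} ESS(π_{(k+1)/n}, π_{k/n})] · exp(−(2θ₂/(1−θ₂))·σ̄²/n) ≤ ÊSS_layers`. -/
theorem prod_essFrac_mul_exp_le_ess_path_uniform (S₀ D : X → ℝ) (P : ℕ → X → X → ℝ) {n : ℕ}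
    (hn : n ≠ 0) {ΔD ρ σbar : ℝ} (hD : ∀ x y, |D x - D y| ≤ ΔD) (hPpos : ∀ k x y, 0 < P k x y)
    (hst : ∀ k, IsStationary
      (fun x => Real.exp (-(linAction S₀ D (((k + 1 : ℕ) : ℝ) / n) x))) (P k))
    (hProw : ∀ k x, ∑ y, P k x y = 1)
    (hK : ∀ k, ChiSqContracts (P k) (gibbsLaw (linAction S₀ D (((k + 1 : ℕ) : ℝ) / n))) ρ)
    (hρ : 0 ≤ ρ) (hσ0 : 0 ≤ σbar) (hσ : ∀ c, varD S₀ D c ≤ σbar ^ 2)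
    (hθ1 : ρ * Real.exp (3 * ΔD / n) < 1) :
    (∏ k ∈ Finset.range n, essFrac (gibbsLaw (linAction S₀ D (((k + 1 : ℕ) : ℝ) / n)))
        (gibbsLaw (linAction S₀ D ((k : ℝ) / n))))
      * Real.exp (-(2 * (ρ * Real.exp (3 * ΔD / n)) / (1 - ρ * Real.exp (3 * ΔD / n))
          * (σbar ^ 2 / n)))
      ≤ essFrac (revPathLaw (fun k : Fin (n + 1) => linAction S₀ D ((k : ℝ) / n))
            (fun k : Fin n => P k))
          (pathLaw (gibbsLaw (linAction S₀ D (((0 : Fin (n + 1)) : ℝ) / n))) (fun k : Fin n => P k)) := by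
  set c : ℕ → ℝ := fun k => (k : ℝ) / n with hc
  have hmass := tiltMass_uniform_le S₀ D P hn hD hPpos hProw hK hρ hσ0 hσ hθ1
  have hid := ess_path_eq_prod_essFrac_mul S₀ D c P n hPpos (fun k => hst k)
  simp only [hc] at hid hmass
  rw [hid]
  have hprod : 0 ≤ ∏ k ∈ Finset.range n,
      essFrac (gibbsLaw (linAction S₀ D (((k + 1 : ℕ) : ℝ) / n)))
        (gibbsLaw (linAction S₀ D ((k : ℝ) / n))) :=
    prod_nonneg fun k _ => essFrac_nonneg fun x => (gibbsLaw_pos _ x).le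
  refine mul_le_mul_of_nonneg_left ?_ hprod
  have hp := perfSqMass_pos S₀ D c n
  have hm : 0 < ∑ x, sqTiltLaw S₀ D c P n x := sum_pos (fun x _ => sqTiltLaw_pos hPpos n x) univ_nonempty
  simp only [hc] at hp hm
  rw [Real.exp_neg, inv_eq_one_div, div_le_div_iff₀ (Real.exp_pos _) hm, one_mul]
  exact hmass

/-- The comparison floor with the product identified as the PATH ESS OF PERFECT RELAXATION
(`Theory2.ess_perfect_relaxation`): no `χ²`-contracting relaxation scheme loses more than the
factor `exp(−(2θ₂/(1−θ₂))σ̄²/n)` against perfect relaxation. -/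
theorem ess_perfect_mul_exp_le_ess_path_uniform [DecidableEq X] (S₀ D : X → ℝ)
    (P : ℕ → X → X → ℝ) {n : ℕ} (hn : n ≠ 0) {ΔD ρ σbar : ℝ} (hD : ∀ x y, |D x - D y| ≤ ΔD)
    (hPpos : ∀ k x y, 0 < P k x y)
    (hst : ∀ k, IsStationary
      (fun x => Real.exp (-(linAction S₀ D (((k + 1 : ℕ) : ℝ) / n) x))) (P k))
    (hProw : ∀ k x, ∑ y, P k x y = 1)
    (hK : ∀ k, ChiSqContracts (P k) (gibbsLaw (linAction S₀ D (((k + 1 : ℕ) : ℝ) / n))) ρ)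
    (hρ : 0 ≤ ρ) (hσ0 : 0 ≤ σbar) (hσ : ∀ c, varD S₀ D c ≤ σbar ^ 2)
    (hθ1 : ρ * Real.exp (3 * ΔD / n) < 1) :
    essFrac (revPathLaw (fun k : Fin (n + 1) => linAction S₀ D ((k : ℝ) / n))
              (fun k _ y => gibbsLaw (linAction S₀ D (((k.succ : Fin (n + 1)) : ℝ) / n)) y))
            (pathLaw (gibbsLaw (linAction S₀ D (((0 : Fin (n + 1)) : ℝ) / n)))
              (fun k _ y => gibbsLaw (linAction S₀ D (((k.succ : Fin (n + 1)) : ℝ) / n)) y))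
      * Real.exp (-(2 * (ρ * Real.exp (3 * ΔD / n)) / (1 - ρ * Real.exp (3 * ΔD / n))
          * (σbar ^ 2 / n)))
      ≤ essFrac (revPathLaw (fun k : Fin (n + 1) => linAction S₀ D ((k : ℝ) / n))
            (fun k : Fin n => P k))
          (pathLaw (gibbsLaw (linAction S₀ D (((0 : Fin (n + 1)) : ℝ) / n))) (fun k : Fin n => P k)) := by
  have h := prod_essFrac_mul_exp_le_ess_path_uniform S₀ D P hn hD hPpos hst hProw hK hρ hσ0 hσ hθ1
  have hperf := ess_perfect_relaxation (fun k : Fin (n + 1) => linAction S₀ D ((k : ℝ) / n))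
  simp only [Fin.val_succ, Fin.val_castSucc] at hperf
  rw [Fin.prod_univ_eq_prod_range (fun k => essFrac (gibbsLaw (linAction S₀ D (((k + 1 : ℕ) : ℝ) / n)))
    (gibbsLaw (linAction S₀ D ((k : ℝ) / n)))) n] at hperf
  simp only [Fin.val_succ]
  rw [hperf]
  exact h

/-- Each perfect-relaxation factor is at least `exp(−e^{ΔD/n}·σ̄²/n²)`
(`ESS = (1 + χ²)⁻¹`, `χ²(π_{(k+1)/n} ‖ π_{k/n}) ≤ e^{ΔD/n}·Var(D)/n²`). -/
theorem exp_le_essFrac_uniform_step (S₀ D : X → ℝ) {n : ℕ} {ΔD σbar : ℝ}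
    (hD : ∀ x y, |D x - D y| ≤ ΔD) (hσ : ∀ c, varD S₀ D c ≤ σbar ^ 2) (k : ℕ) :
    Real.exp (-(Real.exp (ΔD / n) * (σbar ^ 2 / (n : ℝ) ^ 2)))
      ≤ essFrac (gibbsLaw (linAction S₀ D (((k + 1 : ℕ) : ℝ) / n)))
          (gibbsLaw (linAction S₀ D ((k : ℝ) / n))) := by
  set p := gibbsLaw (linAction S₀ D (((k + 1 : ℕ) : ℝ) / n)) with hp
  set q := gibbsLaw (linAction S₀ D ((k : ℝ) / n)) with hq
  set t := Real.exp (ΔD / n) * (σbar ^ 2 / (n : ℝ) ^ 2) with ht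
  have hχ := chiSqDiv_eq_inv_essFrac_sub_one (p := p) (q := q) (gibbsLaw_pos _) (sum_gibbsLaw _)
    (sum_gibbsLaw _)
  have hess0 : 0 < essFrac p q := essFrac_pos (gibbsLaw_pos _) (sum_gibbsLaw _)
  have hess : essFrac p q = (1 + chiSqDiv p q)⁻¹ := by
    rw [hχ, add_sub_cancel, inv_inv]
  -- χ² of one uniform step
  have hsq := sqrt_chiSqDiv_gibbsLaw_linAction_le S₀ D hD (((k + 1 : ℕ) : ℝ) / n) ((k : ℝ) / n)
  have hstep : |(k : ℝ) / n - ((k + 1 : ℕ) : ℝ) / n| = 1 / n := by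
    rw [abs_sub_comm, uniform_step, abs_of_nonneg (by positivity)]
  rw [hstep] at hsq
  have hχ0 : 0 ≤ chiSqDiv p q := chiSqDiv_nonneg_of_nonneg (fun x => (gibbsLaw_pos _ x).le) p
  have hB0 : 0 ≤ Real.exp (1 / n * ΔD / 2) * (1 / n * Real.sqrt (varD S₀ D (((k + 1 : ℕ) : ℝ) / n))) := by
    positivity
  have hχle : chiSqDiv p q ≤ t := by
    have h2 := pow_le_pow_left₀ (Real.sqrt_nonneg _) hsq 2
    rw [Real.sq_sqrt hχ0] at h2
    refine h2.trans ?_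
    have hE2 : Real.exp (1 / (n : ℝ) * ΔD / 2) ^ 2 = Real.exp (ΔD / n) := by
      rw [← Real.exp_nat_mul]; congr 1; push_cast; ring
    rw [mul_pow, mul_pow, Real.sq_sqrt (varD_nonneg S₀ D _), hE2, ht]
    refine mul_le_mul_of_nonneg_left ?_ (Real.exp_pos _).le
    calc (1 / (n : ℝ)) ^ 2 * varD S₀ D (((k + 1 : ℕ) : ℝ) / n)
        ≤ (1 / (n : ℝ)) ^ 2 * σbar ^ 2 := mul_le_mul_of_nonneg_left (hσ _) (sq_nonneg _)
      _ = σbar ^ 2 / (n : ℝ) ^ 2 := by ring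
  rw [hess]
  have ht1 : 0 < 1 + t := by positivity
  have hχ1 : 0 < 1 + chiSqDiv p q := by linarith
  rw [Real.exp_neg, inv_eq_one_div, inv_eq_one_div, div_le_div_iff₀ (Real.exp_pos _) hχ1,
    one_mul, one_mul]
  calc 1 + chiSqDiv p q ≤ 1 + t := by linarith
    _ ≤ Real.exp t := by linarith [Real.add_one_le_exp t]

/-- **THE ESS FLOOR FOR ARBITRARY LAYERS (uniform grid).**  Positive layers `P k` with unit row sums
leaving each Boltzmann weight `e^{−S_{(k+1)/n}}` invariant and `χ²`-contracting towards
`π_{(k+1)/n}` with `ρ ≥ 0` (`ρ = λ⋆` for reversible irreducible layers), `|D x − D y| ≤ ΔD`,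
`Var_c(D) ≤ σ̄²` for all `c`, `θ₂ = ρ·e^{3ΔD/n} < 1`:
`exp(−(e^{ΔD/n} + 2θ₂/(1−θ₂))·σ̄²/n) ≤ ÊSS`.  As `n → ∞`: `−log ÊSS ≤ (1+ρ)/(1−ρ)·σ̄²/n·(1+o(1))`
— the `2τ̄·σ̄²/n` law as a certified upper envelope on `−log ÊSS`. -/
theorem exp_le_ess_path_uniform (S₀ D : X → ℝ) (P : ℕ → X → X → ℝ) {n : ℕ} (hn : n ≠ 0)
    {ΔD ρ σbar : ℝ} (hD : ∀ x y, |D x - D y| ≤ ΔD) (hPpos : ∀ k x y, 0 < P k x y)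
    (hst : ∀ k, IsStationary
      (fun x => Real.exp (-(linAction S₀ D (((k + 1 : ℕ) : ℝ) / n) x))) (P k))
    (hProw : ∀ k x, ∑ y, P k x y = 1)
    (hK : ∀ k, ChiSqContracts (P k) (gibbsLaw (linAction S₀ D (((k + 1 : ℕ) : ℝ) / n))) ρ)
    (hρ : 0 ≤ ρ) (hσ0 : 0 ≤ σbar) (hσ : ∀ c, varD S₀ D c ≤ σbar ^ 2)
    (hθ1 : ρ * Real.exp (3 * ΔD / n) < 1) :
    Real.exp (-((Real.exp (ΔD / n)
        + 2 * (ρ * Real.exp (3 * ΔD / n)) / (1 - ρ * Real.exp (3 * ΔD / n))) * (σbar ^ 2 / n)))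
      ≤ essFrac (revPathLaw (fun k : Fin (n + 1) => linAction S₀ D ((k : ℝ) / n))
            (fun k : Fin n => P k))
          (pathLaw (gibbsLaw (linAction S₀ D (((0 : Fin (n + 1)) : ℝ) / n))) (fun k : Fin n => P k)) := by
  have h := prod_essFrac_mul_exp_le_ess_path_uniform S₀ D P hn hD hPpos hst hProw hK hρ hσ0 hσ hθ1
  refine le_trans ?_ h
  have hn' : (0 : ℝ) < n := Nat.cast_pos.mpr (Nat.pos_of_ne_zero hn)
  -- the perfect-relaxation product is at least exp(−e^{ΔD/n} σ̄²/n)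
  have hprod : Real.exp (-(Real.exp (ΔD / n) * (σbar ^ 2 / n)))
      ≤ ∏ k ∈ Finset.range n, essFrac (gibbsLaw (linAction S₀ D (((k + 1 : ℕ) : ℝ) / n)))
          (gibbsLaw (linAction S₀ D ((k : ℝ) / n))) := by
    have hstep := fun k => exp_le_essFrac_uniform_step S₀ D (n := n) hD hσ k
    calc Real.exp (-(Real.exp (ΔD / n) * (σbar ^ 2 / n)))
        = ∏ _k ∈ Finset.range n, Real.exp (-(Real.exp (ΔD / n) * (σbar ^ 2 / (n : ℝ) ^ 2))) := by
          rw [Finset.prod_const, Finset.card_range, ← Real.exp_nat_mul]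
          congr 1
          field_simp
      _ ≤ _ := Finset.prod_le_prod (fun k _ => (Real.exp_pos _).le) fun k _ => hstep k
  rw [show -((Real.exp (ΔD / n)
        + 2 * (ρ * Real.exp (3 * ΔD / n)) / (1 - ρ * Real.exp (3 * ΔD / n))) * (σbar ^ 2 / n))
      = -(Real.exp (ΔD / n) * (σbar ^ 2 / n))
        + -(2 * (ρ * Real.exp (3 * ΔD / n)) / (1 - ρ * Real.exp (3 * ΔD / n)) * (σbar ^ 2 / n))
      by ring, Real.exp_add]
  exact mul_le_mul_of_nonneg_right hprod (Real.exp_pos _).le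

/-- Stationarity of the Boltzmann WEIGHT from detailed balance with the Gibbs LAW. -/
theorem isStationary_exp_of_detailedBalance_gibbsLaw {S : X → ℝ} {P : X → X → ℝ}
    (hDB : DetailedBalance (gibbsLaw S) P) (hrow : ∀ x, ∑ y, P x y = 1) :
    IsStationary (fun x => Real.exp (-(S x))) P := by
  intro y
  have h := hDB.isStationary hrow y
  have hZ := partitionFn_pos S
  have e : ∀ x, Real.exp (-(S x)) = partitionFn S * gibbsLaw S x := by
    intro x; unfold gibbsLaw; field_simp
  simp_rw [e, mul_assoc, ← mul_sum, h]

/-- **Reversible irreducible positive layers**: the ESS floor with `ρ = max_k λ⋆(P_k)` and no other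
hypothesis (stationarity from detailed balance; the contraction from Levin–Peres (12.8) via
`chiSqContracts_of_reversible`). -/
theorem exp_le_ess_path_uniform_of_reversible [DecidableEq X] (S₀ D : X → ℝ)
    (P : ℕ → X → X → ℝ) {n : ℕ} (hn : n ≠ 0) {ΔD ρ σbar : ℝ} (hD : ∀ x y, |D x - D y| ≤ ΔD)
    (hP : ∀ k, IsRowStochastic (P k)) (hPpos : ∀ k x y, 0 < P k x y)
    (hDB : ∀ k, DetailedBalance (gibbsLaw (linAction S₀ D (((k + 1 : ℕ) : ℝ) / n))) (P k))
    (hirr : ∀ k, IsIrreducible (P k)) (hlam : ∀ k, lambdaStar (P k) ≤ ρ)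
    (hσ0 : 0 ≤ σbar) (hσ : ∀ c, varD S₀ D c ≤ σbar ^ 2)
    (hθ1 : ρ * Real.exp (3 * ΔD / n) < 1) :
    Real.exp (-((Real.exp (ΔD / n)
        + 2 * (ρ * Real.exp (3 * ΔD / n)) / (1 - ρ * Real.exp (3 * ΔD / n))) * (σbar ^ 2 / n)))
      ≤ essFrac (revPathLaw (fun k : Fin (n + 1) => linAction S₀ D ((k : ℝ) / n))
            (fun k : Fin n => P k))
          (pathLaw (gibbsLaw (linAction S₀ D (((0 : Fin (n + 1)) : ℝ) / n))) (fun k : Fin n => P k)) := by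
  have hρ : 0 ≤ ρ := (lambdaStar_nonneg (P 0)).trans (hlam 0)
  refine exp_le_ess_path_uniform S₀ D P hn hD hPpos
    (fun k => isStationary_exp_of_detailedBalance_gibbsLaw (hDB k) (hP k).2)
    (fun k => (hP k).2) (fun k => ?_) hρ hσ0 hσ hθ1
  exact (chiSqContracts_of_reversible (gibbsLaw_pos _) (sum_gibbsLaw _) (hP k) (hDB k)
    (hirr k)).mono (fun x => (gibbsLaw_pos _ x).le) (lambdaStar_nonneg _) (hlam k)

end Uniform

end Summit.Ventures.LatticeQCDFlow.Scaling
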